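import Literature.NumberTheory.Rogawski1990.FinExplicitTransferFactorNondegenerate
import Literature.NumberTheory.Automorphic.AdelicVectorHeightGalois
import Literature.NumberTheory.Automorphic.UnitaryGroupLocalCongr
import HarnessLib

/-!
# The central-character rule `Δ‴_v(zγ_H, zγ′) = μ_v(z) · Δ‴_v(γ_H, γ′)` for Rogawski's explicit FINITE-place transfer factor
# (Rogawski 1990 §4.9 p. 55: «for `z ∈ Z`, `Δ_{G∕H}(zγ) = μ(z)Δ_{G∕H}(γ)`»; finite twin of ★ `ArchExplicitTransferFactorCentral`)

Topic `NumberTheory/Rogawski1990`; namespace `Literature.NumberTheory.Rogawski1990`.  THEOREMS ONLY (no `def` ∕ fact ∕ `sorry` ∕ instance ∕ notation);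
imports ★ `FinExplicitTransferFactorNondegenerate` (B-p12; hence ★ N1f `FinExplicitTransferFactor`), ★ `AdelicVectorHeightGalois` (`norm_galAdicCompletionMap`)
and ★ `UnitaryGroupLocalCongr` (`adelicForm_map_adeleToLocal`).  Cell `pub/hodgecm-mathlib`, F0∕P3a, topic T6, seat B-p12 (g25) (desk table #4 row (1),
item (m1), finite half).  HONEST LABEL: HC_CM is proved only modulo the printed citations («named inputs remaining 2») until rung 0 closes; this file proves
nothing of them — it records how print's finite factor `Δ‴_v` (★ `finExplicitDelta`) transforms under the CENTRE `Z_v = U(1)(L⁺_v)` of `H_v` and `G′_v`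
(the rule by which transfer passes to the spaces `C(G, ω)`, [§4.9 p. 55, Prop. 4.9.1]).

THE MATHEMATICS (local field `F = L⁺_v`, `E = ∏_{w∣v} L_w`, `σ = c ⊗ 1` = ★ `conjLocal`).  «`z` central with scalar `ζ ∈ E`» is phrased by hypotheses on the
matrices (`zH.1 = ζ·1₂`, `zH.2 = ζ·1₁`, `z = ζ·1₃`), so no definition is added; `ζ ∈ U(1)(L⁺_v)` reads `σ(ζ)·ζ = 1` (`conjLocal_central_mul_self`).
For `γ_H = (g, u)`: `u ↦ ζu`, `χ_{ζg}(ζu) = ζ²χ_g(u)`, `det(ζg)⁻¹·ζ² = det g⁻¹`, so `τ_v`'s argument is INVARIANT and `τ_v ↦ μ_v(ζ)·τ_v` (★ `finHeckeValue` is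
multiplicative on units — ★ `HeckeCharacter.semilocalComponent` is a monoid homomorphism); `D_{G∕H,v} = (Π_{w∣v} ‖χ_g(u)_w‖_w)^{1∕2}` is INVARIANT because
**`Π_{w∣v} ‖ζ_w‖_w = 1`** — NOT placewise at a split `v` (`ζ = (t, σt⁻¹)`), but `σ(ζ)_w ζ_w = 1` with `‖σ(ζ)_w‖_w = ‖ζ_{c⁻¹w}‖_{c⁻¹w}` (★ `norm_galAdicCompletionMap`)
and `w ↦ c⁻¹w` permutes the places above `v` (`prod_norm_central_eq_one`); `P_v ↦ ζ² P_v`, and the relative position `x_v` is EXACTLY invariant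
(`σ(ζ²)ζ² = 1`, same first non-zero column), so `κ_v` is invariant; matching is invariant (a central unit scalar commutes with every conjugator).
Hence **`finExplicitDelta_central_mul`**: `Δ‴_v(z_H γ_H, z γ′) = μ_v(ζ) · Δ‴_v(γ_H, γ′)`.

## References
* [Rogawski1990] J. D. Rogawski, *Automorphic Representations of Unitary Groups in Three Variables*, Ann. of Math. Stud. 123 (1990): §4.9 p. 55 (`τ`, `D_{G∕H}`,
  «`Δ_{G∕H}(zγ) = μ(z)Δ_{G∕H}(γ)`», Prop. 4.9.1 on `C(G, ω)`), §4.3 p. 43, §3.5 Prop. 3.5.2 (c) p. 29, §14.6 p. 242.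
* [CasselsFrohlichANT1967] J. W. S. Cassels, A. Fröhlich (eds.), *Algebraic Number Theory* (1967), Ch. II §10–§11 (`L ⊗_K K_v = ∏_{w∣v} L_w`; `|N x|_v = ∏_{w∣v} ‖x_w‖_w`).
-/

set_option autoImplicit false

noncomputable section

open NumberField IsDedekindDomain Matrix Polynomial
open Literature.NumberTheory.GaloisRepresentations
open scoped MatrixGroups

namespace Literature.NumberTheory.Rogawski1990

open Literature.NumberTheory.Automorphic

section Central

variable (L : Type) [Field L] [NumberField L] [IsCMField L] (v : HeightOneSpectrum (𝓞 ↥(maximalRealSubfield L)))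
  (H' : Matrix (Fin 3) (Fin 3) L)
  (zH a : (UnitaryGroup.cmDatum L 2 (Matrix.of fun i j : Fin 2 => if i.val + j.val + 1 = 2 then (1 : L) else 0)).Local v ×
      (UnitaryGroup.cmDatum L 1 (Matrix.of fun i j : Fin 1 => if i.val + j.val + 1 = 1 then (1 : L) else 0)).Local v)
  (z b : (UnitaryGroup.cmDatum L 3 H').Local v) (ζ : UnitaryGroup.LocalRing L v)
  (hz1 : (zH.1.val.val : Matrix (Fin 2) (Fin 2) (UnitaryGroup.LocalRing L v)) = ζ • 1)
  (hz2 : (zH.2.val.val : Matrix (Fin 1) (Fin 1) (UnitaryGroup.LocalRing L v)) = ζ • 1)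
  (hz : (z.val.val : Matrix (Fin 3) (Fin 3) (UnitaryGroup.LocalRing L v)) = ζ • 1)

omit [IsCMField L] in
/-- `E = ∏_{w∣v} L_w` is non-trivial (there is a place above `v`). [folklore] -/
private theorem nontrivial_localRing : Nontrivial (UnitaryGroup.LocalRing L v) := by
  obtain ⟨w⟩ := (inferInstance : Nonempty (UnitaryGroup.PlacesOver L v))
  exact ⟨⟨0, 1, fun h => zero_ne_one (congrFun h w)⟩⟩

/-! ## §1 `μ_v` is multiplicative on units; `ζ` from the centre -/

omit [IsCMField L] in
/-- `μ_v(xy) = μ_v(x) μ_v(y)` for units `x, y ∈ E` (★ `semilocalComponent` is a monoid homomorphism). [cite: Rogawski1990, §4.9 p. 55] -/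
theorem finHeckeValue_mul (μ : HeckeCharacter L) {x y : UnitaryGroup.LocalRing L v} (hx : IsUnit x) (hy : IsUnit y) :
    finHeckeValue L v μ (x * y) = finHeckeValue L v μ x * finHeckeValue L v μ y := by
  rw [finHeckeValue_of_isUnit L v μ (hx.mul hy), finHeckeValue_of_isUnit L v μ hx, finHeckeValue_of_isUnit L v μ hy, IsUnit.unit_mul,
    map_mul, Units.val_mul]

include hz2 in
/-- `u(z_H) = ζ`. [cite: Rogawski1990, §4.9 p. 55] -/
theorem finGammaTwo_of_central : finGammaTwo L v zH = ζ := by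
  unfold finGammaTwo
  rw [hz2, Matrix.smul_apply, Matrix.one_apply_eq, smul_eq_mul, mul_one]

include hz2 in
/-- `ζ` is a unit of `E` (local helper; the statement shape coincides with ★ `isUnit_of_central` at `∞`). [cite: Rogawski1990, §4.9 p. 55] -/
private theorem isUnit_of_finCentral : IsUnit ζ := by
  rw [← finGammaTwo_of_central L v zH ζ hz2]
  exact isUnit_finGammaTwo L v zH

include hz2 in
/-- **`σ(ζ)·ζ = 1`**: `ζ ∈ U(1)(L⁺_v)` (membership of `z_H.2`, form `Φ₁ = (1)`). [cite: Rogawski1990, §4.9 p. 55] -/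
theorem conjLocal_central_mul_self : UnitaryGroup.conjLocal L (IsCMField.complexConj L) v ζ * ζ = 1 := by
  have h := congrFun (congrFun (mem_unitaryGroupOfForm_iff.mp zH.2.2) 0) 0
  rw [hz2, UnitaryGroup.adelicForm_map_adeleToLocal] at h
  simpa [Matrix.mul_apply, Matrix.map_apply, Matrix.of_apply, Matrix.one_apply] using h

include hz2 in
/-- **`Π_{w∣v} ‖ζ_w‖_w = 1`** — from `σ(ζ)_w ζ_w = 1`, `‖σ(ζ)_w‖_w = ‖ζ_{c⁻¹w}‖_{c⁻¹w}` (★ `norm_galAdicCompletionMap`) and the permutation `w ↦ c⁻¹ w` of the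
places above `v` (at a split `v` the individual `‖ζ_w‖_w` need not be `1`). [cite: CasselsFrohlichANT1967, Ch. II §11] -/
theorem prod_norm_central_eq_one : ∏ w : UnitaryGroup.PlacesOver L v, ‖ζ w‖ = 1 := by
  have hrel : ∀ w : UnitaryGroup.PlacesOver L v,
      ‖ζ (UnitaryGroup.PlacesOver.galInv (IsCMField.complexConj L) w)‖ * ‖ζ w‖ = 1 := by
    intro w
    have h := congrFun (conjLocal_central_mul_self L v zH ζ hz2) w
    rw [Pi.mul_apply, Pi.one_apply, UnitaryGroup.conjLocal_apply] at h
    have hn := congrArg (fun t => ‖t‖) h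
    simp only [norm_mul, norm_one, norm_galAdicCompletionMap] at hn
    exact hn
  have hinj : Function.Injective (UnitaryGroup.PlacesOver.galInv (IsCMField.complexConj L) (v := v)) := by
    intro w₁ w₂ h
    have h1 : (IsCMField.complexConj L)⁻¹ • w₁.1 = (IsCMField.complexConj L)⁻¹ • w₂.1 := congrArg Subtype.val h
    exact Subtype.ext (smul_left_cancel _ h1)
  have hbij : Function.Bijective (UnitaryGroup.PlacesOver.galInv (IsCMField.complexConj L) (v := v)) :=
    (Finite.injective_iff_bijective).1 hinj
  have hsq : (∏ w : UnitaryGroup.PlacesOver L v, ‖ζ w‖) * (∏ w : UnitaryGroup.PlacesOver L v, ‖ζ w‖) = 1 := by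
    nth_rewrite 1 [← hbij.prod_comp (fun w => ‖ζ w‖)]
    rw [← Finset.prod_mul_distrib]
    exact Finset.prod_eq_one fun w _ => hrel w
  have hpos : 0 ≤ ∏ w : UnitaryGroup.PlacesOver L v, ‖ζ w‖ := Finset.prod_nonneg fun w _ => norm_nonneg _
  nlinarith [hsq, hpos]

/-! ## §2 The `γ_H`-side quantities under a central `z_H` -/

include hz2 in
/-- `u(z_H γ_H) = ζ · u(γ_H)`. [cite: Rogawski1990, §4.9 p. 55] -/
theorem finGammaTwo_central_mul : finGammaTwo L v (zH * a) = ζ * finGammaTwo L v a := by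
  have h : ((zH * a).2.val.val : Matrix (Fin 1) (Fin 1) (UnitaryGroup.LocalRing L v)) = zH.2.val.val * a.2.val.val := rfl
  unfold finGammaTwo
  rw [h, hz2, Matrix.smul_mul, Matrix.one_mul, Matrix.smul_apply, smul_eq_mul]

include hz1 in
/-- The `U(Φ₂)`-part of `z_H γ_H` is `ζ · g`. [cite: Rogawski1990, §4.9 p. 55] -/
theorem coe_fst_finCentral_mul :
    ((zH * a).1.val.val : Matrix (Fin 2) (Fin 2) (UnitaryGroup.LocalRing L v)) = ζ • (a.1.val.val : Matrix (Fin 2) (Fin 2) (UnitaryGroup.LocalRing L v)) := by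
  have h : ((zH * a).1.val.val : Matrix (Fin 2) (Fin 2) (UnitaryGroup.LocalRing L v)) = zH.1.val.val * a.1.val.val := rfl
  rw [h, hz1, Matrix.smul_mul, Matrix.one_mul]

include hz1 hz2 in
/-- **`χ_{ζg}(ζu) = ζ² · χ_g(u)`** (Mathlib `charpoly_fin_two`). [cite: Rogawski1990, §4.9 p. 55] -/
theorem eval_finCharpolyTwo_central_mul :
    (finCharpolyTwo L v (zH * a)).eval (finGammaTwo L v (zH * a)) = ζ ^ 2 * (finCharpolyTwo L v a).eval (finGammaTwo L v a) := by
  haveI := nontrivial_localRing L v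
  unfold finCharpolyTwo
  rw [coe_fst_finCentral_mul L v zH a ζ hz1, finGammaTwo_central_mul L v zH a ζ hz2, Matrix.charpoly_fin_two, Matrix.charpoly_fin_two,
    Matrix.trace_smul, Matrix.det_smul, Fintype.card_fin]
  simp only [eval_add, eval_sub, eval_mul, eval_pow, eval_X, eval_C, smul_eq_mul]
  ring

include hz1 in
/-- `det((ζg)⁻¹) · ζ² = det(g⁻¹)`. [cite: Rogawski1990, §4.9 p. 55] -/
theorem det_inv_fst_finCentral_mul :
    (((zH * a).1.val⁻¹).val : Matrix (Fin 2) (Fin 2) (UnitaryGroup.LocalRing L v)).det * ζ ^ 2 =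
      ((a.1.val⁻¹).val : Matrix (Fin 2) (Fin 2) (UnitaryGroup.LocalRing L v)).det := by
  have h : (zH * a).1.val = zH.1.val * a.1.val := rfl
  have hdetz : (zH.1.val.val : Matrix (Fin 2) (Fin 2) (UnitaryGroup.LocalRing L v)).det = ζ ^ 2 := by
    rw [hz1, Matrix.det_smul, Fintype.card_fin, Matrix.det_one, mul_one]
  have hinv : ((zH.1.val⁻¹).val : Matrix (Fin 2) (Fin 2) (UnitaryGroup.LocalRing L v)).det * ζ ^ 2 = 1 := by
    rw [← hdetz, ← Matrix.det_mul, ← Units.val_mul, inv_mul_cancel, Units.val_one, Matrix.det_one]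
  rw [h, _root_.mul_inv_rev, Units.val_mul, Matrix.det_mul, mul_assoc, hinv, mul_one]

include hz1 hz2 in
/-- **`τ_v`'s argument is central-invariant**. [cite: Rogawski1990, §4.9 p. 55] -/
theorem finTauArg_central_mul : finTauArg L v (zH * a) = finTauArg L v a := by
  unfold finTauArg
  rw [eval_finCharpolyTwo_central_mul L v zH a ζ hz1 hz2, ← det_inv_fst_finCentral_mul L v zH a ζ hz1]
  ring

include hz1 hz2 in
/-- **`τ_v(z_H γ_H) = μ_v(ζ) · τ_v(γ_H)`**. [cite: Rogawski1990, §4.9 p. 55] -/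
theorem finTau_central_mul (μ : HeckeCharacter L) : finTau L v (zH * a) μ = finHeckeValue L v μ ζ * finTau L v a μ := by
  unfold finTau
  rw [finTauArg_central_mul L v zH a ζ hz1 hz2, finGammaTwo_central_mul L v zH a ζ hz2,
    finHeckeValue_mul L v μ (isUnit_of_finCentral L v zH ζ hz2) (isUnit_finGammaTwo L v a), mul_assoc]

include hz1 hz2 in
/-- **`D_{G∕H,v}(z_H γ_H) = D_{G∕H,v}(γ_H)`** (`Π_{w∣v} ‖ζ_w‖ = 1`). [cite: Rogawski1990, §4.9 p. 55] -/
theorem finWeylRatio_central_mul : finWeylRatio L v (zH * a) = finWeylRatio L v a := by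
  unfold finWeylRatio
  rw [eval_finCharpolyTwo_central_mul L v zH a ζ hz1 hz2]
  congr 1
  have h : ∀ w : UnitaryGroup.PlacesOver L v,
      ‖(ζ ^ 2 * (finCharpolyTwo L v a).eval (finGammaTwo L v a)) w‖ = ‖ζ w‖ ^ 2 * ‖((finCharpolyTwo L v a).eval (finGammaTwo L v a)) w‖ := by
    intro w
    rw [Pi.mul_apply, Pi.pow_apply, norm_mul, norm_pow]
  simp_rw [h]
  rw [Finset.prod_mul_distrib, Finset.prod_pow, prod_norm_central_eq_one L v zH ζ hz2, one_pow, one_mul]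

/-! ## §3 The pair quantities: `P_v ↦ ζ² P_v`, `x_v` and `κ_v` invariant, matching invariant -/

include hz1 hz in
/-- **`P_v(z_H γ_H, z γ′) = ζ² · P_v(γ_H, γ′)`**. [cite: Rogawski1990, §4.9 p. 55] -/
theorem finEigenlineProjector_central_mul :
    finEigenlineProjector L v H' (zH * a) (z * b) = ζ ^ 2 • finEigenlineProjector L v H' a b := by
  have hb : ((z * b).val.val : Matrix (Fin 3) (Fin 3) (UnitaryGroup.LocalRing L v)) = ζ • (b.val.val : Matrix (Fin 3) (Fin 3) (UnitaryGroup.LocalRing L v)) := by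
    have h : ((z * b).val.val : Matrix (Fin 3) (Fin 3) (UnitaryGroup.LocalRing L v)) = z.val.val * b.val.val := rfl
    rw [h, hz, Matrix.smul_mul, Matrix.one_mul]
  dsimp only [finEigenlineProjector]
  rw [hb, coe_fst_finCentral_mul L v zH a ζ hz1, Matrix.trace_smul, Matrix.det_smul, Fintype.card_fin]
  simp only [smul_eq_mul, Matrix.smul_mul, Matrix.mul_smul, smul_smul, smul_sub, smul_add]
  ring_nf

include hz1 hz2 hz in
/-- **The column form values `x_j = p_jᴴ H′_v p_j` are EXACTLY central-invariant** (`σ(ζ²)·ζ² = 1`). [cite: Rogawski1990, §3.5 Prop. 3.5.2 (c) p. 29] -/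
theorem finColumnFormValue_central_mul (j : Fin 3) :
    finColumnFormValue L v H' (zH * a) (z * b) j = finColumnFormValue L v H' a b j := by
  have h1 := conjLocal_central_mul_self L v zH ζ hz2
  unfold finColumnFormValue
  rw [finEigenlineProjector_central_mul L v H' zH a z b ζ hz1 hz]
  refine Finset.sum_congr rfl fun i _ => Finset.sum_congr rfl fun k _ => ?_
  rw [Matrix.smul_apply, Matrix.smul_apply, smul_eq_mul, smul_eq_mul, map_mul, map_pow,
    show UnitaryGroup.conjLocal L (IsCMField.complexConj L) v ζ ^ 2 * UnitaryGroup.conjLocal L (IsCMField.complexConj L) v (finEigenlineProjector L v H' a b i j) *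
        ((UnitaryGroup.adelicForm L 3 H').map (UnitaryGroup.adeleToLocal L v)) i k * (ζ ^ 2 * finEigenlineProjector L v H' a b k j) =
      (UnitaryGroup.conjLocal L (IsCMField.complexConj L) v ζ * ζ) ^ 2 *
        (UnitaryGroup.conjLocal L (IsCMField.complexConj L) v (finEigenlineProjector L v H' a b i j) *
          ((UnitaryGroup.adelicForm L 3 H').map (UnitaryGroup.adeleToLocal L v)) i k * finEigenlineProjector L v H' a b k j) by ring,
    h1, one_pow, one_mul]

include hz1 hz2 hz in
open scoped Classical in
/-- **The relative position `x_v(γ_H, γ′)` is central-invariant** (same first non-zero column of `P_v`, same value). [cite: Rogawski1990, §3.5 Prop. 3.5.2 (c) p. 29] -/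
theorem finRelPos_central_mul : finRelPos L v H' (zH * a) (z * b) = finRelPos L v H' a b := by
  have hu : IsUnit (ζ ^ 2) := (isUnit_of_finCentral L v zH ζ hz2).pow 2
  have hiff : ∀ i j, (finEigenlineProjector L v H' (zH * a) (z * b) i j ≠ 0) = (finEigenlineProjector L v H' a b i j ≠ 0) := by
    intro i j
    rw [finEigenlineProjector_central_mul L v H' zH a z b ζ hz1 hz, Matrix.smul_apply, smul_eq_mul]
    exact propext hu.mul_right_eq_zero.not
  unfold finRelPos
  simp only [hiff, finColumnFormValue_central_mul L v H' zH a z b ζ hz1 hz2 hz]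

include hz1 hz2 hz in
open scoped Classical in
/-- **`κ_v(z_H γ_H, z γ′) = κ_v(γ_H, γ′)`**. [cite: Rogawski1990, §14.6 p. 242; §4.3 p. 43] -/
theorem finKappaAt_central_mul : finKappaAt L v H' (zH * a) (z * b) = finKappaAt L v H' a b := by
  have hP0 : (finEigenlineProjector L v H' (zH * a) (z * b) = 0) = (finEigenlineProjector L v H' a b = 0) := by
    rw [finEigenlineProjector_central_mul L v H' zH a z b ζ hz1 hz]
    exact propext ((isUnit_of_finCentral L v zH ζ hz2).pow 2).smul_eq_zero
  unfold finKappaAt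
  simp only [hP0, finRelPos_central_mul L v H' zH a z b ζ hz1 hz2 hz]

include hz1 hz2 hz in
/-- **Matching is central-invariant**: `ι_v(z_H γ_H) ↔ z γ′` iff `ι_v(γ_H) ↔ γ′` (`ι_v(z_H)` and `z` are the same central unit scalar of `GL₃(E)`).
[cite: Rogawski1990, §14.1 p. 232; §4.9 p. 55] -/
theorem isLocalNormPair_central_mul : IsLocalNormPair L H' v (zH * a) (z * b) ↔ IsLocalNormPair L H' v a b := by
  rw [isLocalNormPair_iff, isLocalNormPair_iff, map_mul]
  have hι : ((endoEmbLocal L v zH).val : GL (Fin 3) (UnitaryGroup.LocalRing L v)) = z.val := by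
    apply Units.ext
    rw [hz, coe_endoEmbLocal, coe_endoGL_eq, hz1, hz2]
    refine Matrix.ext fun i j => ?_
    fin_cases i <;> fin_cases j <;> simp [Matrix.smul_apply]
  set ζG := (z.val : GL (Fin 3) (UnitaryGroup.LocalRing L v)) with hζG
  have hcen : ∀ x : GL (Fin 3) (UnitaryGroup.LocalRing L v), ζG * x = x * ζG := fun x => by
    apply Units.ext
    rw [Units.val_mul, Units.val_mul, hz, Matrix.smul_mul, Matrix.mul_smul, Matrix.one_mul, Matrix.mul_one]
  have key : ∀ x y : GL (Fin 3) (UnitaryGroup.LocalRing L v), IsConj (ζG * x) (ζG * y) ↔ IsConj x y := fun x y => by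
    constructor
    · intro h
      obtain ⟨c, hc⟩ := isConj_iff.1 h
      refine isConj_iff.2 ⟨c, ?_⟩
      have h2 : c * (ζG * x) * c⁻¹ = ζG * (c * x * c⁻¹) := by
        calc c * (ζG * x) * c⁻¹ = (c * ζG) * x * c⁻¹ := by group
          _ = (ζG * c) * x * c⁻¹ := by rw [hcen c]
          _ = ζG * (c * x * c⁻¹) := by group
      rw [h2] at hc
      exact mul_left_cancel hc
    · intro h
      obtain ⟨c, hc⟩ := isConj_iff.1 h
      refine isConj_iff.2 ⟨c, ?_⟩
      have h2 : c * (ζG * x) * c⁻¹ = ζG * (c * x * c⁻¹) := by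
        calc c * (ζG * x) * c⁻¹ = (c * ζG) * x * c⁻¹ := by group
          _ = (ζG * c) * x * c⁻¹ := by rw [hcen c]
          _ = ζG * (c * x * c⁻¹) := by group
      rw [h2, hc]
  unfold Corresponds
  have hm : ((endoEmbLocal L v zH * endoEmbLocal L v a).val : GL (Fin 3) (UnitaryGroup.LocalRing L v)) = ζG * (endoEmbLocal L v a).val := by
    rw [← hι]; rfl
  have hm' : ((z * b).val : GL (Fin 3) (UnitaryGroup.LocalRing L v)) = ζG * b.val := rfl
  rw [hm, hm']
  exact key _ _

/-! ## §4 The rule -/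

include hz1 hz2 hz in
open scoped Classical in
/-- **THE CENTRAL-CHARACTER RULE `Δ‴_v(z_H γ_H, z γ′) = μ_v(ζ) · Δ‴_v(γ_H, γ′)`** for print's explicit finite-place factor, `z_H = (ζ·1₂, ζ·1₁) ∈ H_v` and
`z = ζ·1₃ ∈ G′_v` central with the same scalar `ζ ∈ U(1)(L⁺_v)` («`Δ_{G∕H}(zγ) = μ(z)Δ_{G∕H}(γ)`»). [cite: Rogawski1990, §4.9 p. 55] -/
theorem finExplicitDelta_central_mul (μ : HeckeCharacter L) :
    finExplicitDelta L v H' (zH * a) μ (z * b) = finHeckeValue L v μ ζ * finExplicitDelta L v H' a μ b := by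
  by_cases h : IsLocalNormPair L H' v a b
  · rw [finExplicitDelta_of_isLocalNormPair L v H' _ μ ((isLocalNormPair_central_mul L v H' zH a z b ζ hz1 hz2 hz).2 h),
      finExplicitDelta_of_isLocalNormPair L v H' _ μ h, finTau_central_mul L v zH a ζ hz1 hz2 μ, finWeylRatio_central_mul L v zH a ζ hz1 hz2,
      finKappaAt_central_mul L v H' zH a z b ζ hz1 hz2 hz]
    ring
  · rw [finExplicitDelta_of_not_isLocalNormPair L v H' _ μ (fun h' => h ((isLocalNormPair_central_mul L v H' zH a z b ζ hz1 hz2 hz).1 h')),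
      finExplicitDelta_of_not_isLocalNormPair L v H' _ μ h, mul_zero]

end Central

end Literature.NumberTheory.Rogawski1990

end
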